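import Summits.BirchSwinnertonDyer.BirchSwinnertonDyer.Theorems.PrintCFramBottomClassIndexLawFiveLeFlipRungSupply
import HarnessLib

/-!
# Crux `PrintCFram.BottomClassIndexLawFiveLe` (stmt-BirchSwinnertonDyer-20372), line `eisenstein-resource-bdp-line` (registry v27/v28 → next):
# THE 2-ADIC FLIPPED-CUSP RUNG (T6) — `stub_seedOffExc` ⟸ (FlipRung⁶) ∧ (FlipRungTwo⁶) ∧ (SeedOffExcBadOdd⁶); the clause
# «2 ∣ m ∧ p ≢ 7 (mod 8)» LEAVES the research residue
# (cell `bsd-print-cfram`, width seat `bsd-line-cfram-p1-w7` g8; THEOREMS ONLY, `--supports` 20372 `--as helper`; BSD is not proved by any of this)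

HONEST FRAMING. Nothing here is a statement about BSD; no registered stub is closed by this file. LEAD g14's `FlipRung.seedOffExc_of_flipRung_of_bad`
(p706253) derives registry v26's `stub_seedOffExc` from the flipped-cusp rung at the ODD level primes (FlipRung⁶) and the residue (SeedOffExcBad⁶) =
«∃ prime `q ∣ m`, `q ≡ −1 (mod 4p)`» ∨ «`2 ∣ m ∧ p ≢ 7 (mod 8)`»; the second clause is there only because the reading point `K₀ = ℚ(√−p)` has
`d = −p ≡ 5 (mod 8)` when `p ≡ 3 (mod 8)`, while an `m`-admissible seed with `2 ∣ m` needs `d ≡ 1 (mod 8)` (`2` split). This file adds the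
2-ADIC RUNG (FlipRungTwo⁶) — «for a class datum with `2 ∣ m` and any sign pattern `τ` at the odd primes of `m`: if every `K₀` of pattern `τ` with
`d_{K₀} ≡ 1 (mod 8)` has a non-unit field factor, so does every `K₀` of pattern `τ` with `d_{K₀} ≡ 5 (mod 8)`» — and proves

  `seedOffExc_of_flipRung_of_flipRungTwo_of_badOdd : (FlipRung⁶) → (FlipRungTwo⁶) → (SeedOffExcBadOdd⁶) → (v26 stub_seedOffExc VERBATIM)`,

where (SeedOffExcBadOdd⁶) is `stub_seedOffExc`'s text restricted to «∃ prime `q ∣ m`, `q ≡ −1 (mod 4p)`» ALONE. Proof = LEAD's induction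
(Steps 1–2 verbatim, adapted from p706253 §3) and, at Step 3, one application of (FlipRungTwo⁶) to the terminal pattern `q ↦ J(−p | q)` before
reading at `ℚ(√−p)` when `2 ∣ m` and `p ≢ 7 (mod 8)` (then `p ≡ 3 (mod 8)`, `−p ≡ 5 (mod 8)`).

WHY (FlipRungTwo⁶) IS PRINT-DERIVABLE (crux notes `Lines/eisenstein-resource-bdp-line-w7g8-T6.md`, derivation + numerical certificate; typing owed,
items T6a–T6e): for `F ∈ M_{k+1/2}(Γ₀(4M′), ψ)`, `M′` odd, `W = [[64a, b],[64M′, 64]]` (`64a − bM′ = 1`) and the class cut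
`P_c F = (1/8) Σ_{j mod 8} e(−cj/8) F(z + j/8)`: for odd `j`, `τ_j W = γ_j·[[8,−j],[0,8]]` with `γ_j = [[8a + jM′, ·],[8M′, 8 + M′j]] ∈ Γ₀(4M′)`,
so `(P_cF)|W = Σ_{4 ∤ n} w_c(n) a(n) e(nz) + E_c`, `E_c ∈ ℂ[[e(4z)]]`, `w_c(n) = (1/8) Σ_{j odd} ψ(d_j)[ε_{d_j}⁻¹(8M′/d_j)]^{2k+1} ζ₈^{−(c+n)j}`,
`d_j = 8 + M′j`; the weights are `±ζ₈^t/2` on `n + c ≡ 2k+1+2[ψ₂ = χ₄] (mod 4)` (ψ₂ ∈ {1, χ₄}) resp. of modulus `1/(2√2)` on `n + c` odd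
(ψ₂ ∈ {(2/·), χ₄(2/·)}, the `U_8` case) — `p`-adic UNITS for every odd `p`: NO exceptional prime at `2` (contrast `q* ≡ 1 (mod p)` at odd `q`).
On `g = G|U_4` (`e ≡ 3 (mod 4)`) the seed classes `{7m₁, 3m₁} mod 8` are flipped in two steps through the classes `{2, 6}`; on `g = G|U_8`
(`e ≡ 2 (mod 4)`, `ψ₂ = (2/·)`) in one step. Certified: translate identity (72 cases, ≤ 2·10⁻¹¹), flipped-cusp expansion (H_2, H_3, H_3|U_4,
H_3|U_8, H_2|U_4 at M′ ∈ {1,3,5,7}, ≤ 2·10⁻¹⁴), nebentypus of `U_4`/`U_8`/`U_16` (Shimura 1973 Prop. 1.5).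

References: [Cohen1975] Thm. 3.1; [Shimura1973] Prop. 1.3–1.5; [Katz1973] Cor. 1.6.2; [KrizLi2019] §8; crux notes lead-g14 §2, w7g8-T6.
-/

set_option autoImplicit false
-- summit-side namespace `Summit.BirchSwinnertonDyer.BirchSwinnertonDyer.…` (single-conjunct summit, D-0017 layout)
set_option linter.dupNamespace false

noncomputable section

open scoped Classical NumberTheorySymbols
open NumberField DirichletCharacter Literature.NumberTheory.LFunctions
  Literature.NumberTheory.EllipticCurves Literature.NumberTheory.EllipticCurves.KrizLi2019
  Literature.NumberTheory.Congruences Literature.NumberTheory.QuadraticFields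

namespace Summit.BirchSwinnertonDyer.BirchSwinnertonDyer.Theorems.PrintCFram.FlipRung

open Summit.BirchSwinnertonDyer.BirchSwinnertonDyer.Theorems.PrintCFram
open Summit.BirchSwinnertonDyer.BirchSwinnertonDyer.Theorems.PrintCFram.HeegnerFieldSupply
open Summit.BirchSwinnertonDyer.BirchSwinnertonDyer.Theorems.PrintCFram.KummerDictionary
open Summit.BirchSwinnertonDyer.Rank1Residual Summit.BirchSwinnertonDyer.Rank1Residual.X12.O11

/-! ## `stub_seedOffExc` ⟸ (FlipRung⁶) ∧ (FlipRungTwo⁶) ∧ (SeedOffExcBadOdd⁶) -/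

/-- **Registry v26's `stub_seedOffExc` with a SIDE CONDITION `Q` threaded (LEAD's `_cut` socket shape) ⟸ (FlipRung⁶) ∧ (FlipRungTwo⁶) ∧ (SeedOffExcBadOdd⁶ under `Q`).** `hFlip` = LEAD g14's flipped-cusp
rung at the odd level primes (VERBATIM as in `seedOffExc_of_flipRung_of_bad`); `hFlipTwo` = THE 2-ADIC RUNG in Bernoulli currency: for a class
datum with `2 ∣ m` and a sign pattern `τ` (values `±1` at the odd primes of `m`), «every imaginary quadratic `K₀` with `d` odd, `< −4`, `3 ∤ d`,
`J(d | q′) = τ q′` at the odd `q′ ∣ m` and `d ≡ 1 (mod 8)` has a NON-unit field factor» ⟹ «the same for `d ≡ 5 (mod 8)`» (print-derivable: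
Cohen 1975 Thm 3.1, Shimura 1973 Prop. 1.3–1.5 incl. `U_4`/`U_8`, Katz 1973 Cor. 1.6.2, plus the finite lemma mod `8` of the module docstring;
typing owed); `hBadOdd` = `stub_seedOffExc`'s text restricted to the classes with a prime `q ∣ m`, `q ≡ −1 (mod 4p)` (research). PROOF: LEAD's
induction — off the bad primes, flip one at a time the odd `q ∣ m` inert in `ℚ(√−p)` — reaches the pattern of `ℚ(√−p)`; if `2 ∤ m` or
`p ≡ 7 (mod 8)` read there at once (`−p ≡ 1 (mod 8)`); otherwise `p ≡ 3 (mod 8)` and ONE application of `hFlipTwo` moves the family to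
`d ≡ 5 (mod 8) ∋ −p`; the field factor at `ℚ(√−p)` is the reflected class factor (`exists_cmField_fieldFactor_le_imp`), a unit by regularity —
contradiction. Nothing about BSD. [cite: Cohen1975, Thm. 3.1] [cite: Katz1973, Cor. 1.6.2] [cite: Washington1997, Thm. 5.11] [cite: KrizLi2019, §8 (pp. 49–52)] -/
theorem seedOffExc_of_flipRung_of_flipRungTwo_of_badOdd_cut
    (Q : (p : ℕ) → [Fact p.Prime] → (m : ℕ) → DirichletCharacter ℚ_[p] m → ℕ → Prop)
    (hFlip : ∀ (p : ℕ) [Fact p.Prime] (m : ℕ) [NeZero m] (χ : DirichletCharacter ℚ_[p] m) (k : ℕ),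
      (p = 7 ∨ p = 11 ∨ p = 19 ∨ p = 43 ∨ p = 67 ∨ p = 163) →
      m.Coprime p → χ.IsPrimitive → χ.IsQuadratic → (k = (p + 1) / 4 ∨ k = (3 * p - 1) / 4) →
      2 ≤ k → k ≤ p - 2 → χ (-1) * (-1) ^ k = -1 →
      ∀ (τ : ℕ → ℤ) (q : ℕ), q.Prime → q ∣ m → q ≠ 2 →
      (∀ q' : ℕ, q'.Prime → q' ∣ m → q' ≠ 2 → (τ q' = 1 ∨ τ q' = -1)) →
      ¬ ((p : ℤ) ∣ (q : ℤ) * jacobiSym (-1) q - 1) →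
      (∀ (K₀ : Type) [Field K₀] [NumberField K₀] (ε₀ : DirichletCharacter ℚ_[p] (NumberField.discr K₀).natAbs),
        IsImaginaryQuadratic K₀ → Odd (NumberField.discr K₀) → NumberField.discr K₀ < -4 →
        ¬ ((3 : ℤ) ∣ NumberField.discr K₀) →
        (∀ q' : ℕ, q'.Prime → q' ∣ m → q' ≠ 2 → jacobiSym (NumberField.discr K₀) q' = τ q') →
        (2 ∣ m → NumberField.discr K₀ % 8 = 1) → IsKroneckerCharacterOf K₀ ε₀ →
        ‖(k : ℚ_[p])⁻¹ * @generalizedBernoulli ℚ_[p] _ _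
            (changeLevel (dvd_mul_right m (NumberField.discr K₀).natAbs) χ *
              changeLevel (dvd_mul_left (NumberField.discr K₀).natAbs m) ε₀).conductor ⟨conductor_ne_zero _⟩ k
            (changeLevel (dvd_mul_right m (NumberField.discr K₀).natAbs) χ *
              changeLevel (dvd_mul_left (NumberField.discr K₀).natAbs m) ε₀).primitiveCharacter‖ ≤ (p : ℝ)⁻¹) →
      ∀ (K₀ : Type) [Field K₀] [NumberField K₀] (ε₀ : DirichletCharacter ℚ_[p] (NumberField.discr K₀).natAbs),
        IsImaginaryQuadratic K₀ → Odd (NumberField.discr K₀) → NumberField.discr K₀ < -4 →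
        ¬ ((3 : ℤ) ∣ NumberField.discr K₀) →
        (∀ q' : ℕ, q'.Prime → q' ∣ m → q' ≠ 2 → jacobiSym (NumberField.discr K₀) q' = (if q' = q then -τ q' else τ q')) →
        (2 ∣ m → NumberField.discr K₀ % 8 = 1) → IsKroneckerCharacterOf K₀ ε₀ →
        ‖(k : ℚ_[p])⁻¹ * @generalizedBernoulli ℚ_[p] _ _
            (changeLevel (dvd_mul_right m (NumberField.discr K₀).natAbs) χ *
              changeLevel (dvd_mul_left (NumberField.discr K₀).natAbs m) ε₀).conductor ⟨conductor_ne_zero _⟩ k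
            (changeLevel (dvd_mul_right m (NumberField.discr K₀).natAbs) χ *
              changeLevel (dvd_mul_left (NumberField.discr K₀).natAbs m) ε₀).primitiveCharacter‖ ≤ (p : ℝ)⁻¹)
    (hFlipTwo : ∀ (p : ℕ) [Fact p.Prime] (m : ℕ) [NeZero m] (χ : DirichletCharacter ℚ_[p] m) (k : ℕ),
      (p = 7 ∨ p = 11 ∨ p = 19 ∨ p = 43 ∨ p = 67 ∨ p = 163) →
      m.Coprime p → χ.IsPrimitive → χ.IsQuadratic → (k = (p + 1) / 4 ∨ k = (3 * p - 1) / 4) →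
      2 ≤ k → k ≤ p - 2 → χ (-1) * (-1) ^ k = -1 → 2 ∣ m →
      ∀ (τ : ℕ → ℤ), (∀ q' : ℕ, q'.Prime → q' ∣ m → q' ≠ 2 → (τ q' = 1 ∨ τ q' = -1)) →
      (∀ (K₀ : Type) [Field K₀] [NumberField K₀] (ε₀ : DirichletCharacter ℚ_[p] (NumberField.discr K₀).natAbs),
        IsImaginaryQuadratic K₀ → Odd (NumberField.discr K₀) → NumberField.discr K₀ < -4 →
        ¬ ((3 : ℤ) ∣ NumberField.discr K₀) →
        (∀ q' : ℕ, q'.Prime → q' ∣ m → q' ≠ 2 → jacobiSym (NumberField.discr K₀) q' = τ q') →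
        NumberField.discr K₀ % 8 = 1 → IsKroneckerCharacterOf K₀ ε₀ →
        ‖(k : ℚ_[p])⁻¹ * @generalizedBernoulli ℚ_[p] _ _
            (changeLevel (dvd_mul_right m (NumberField.discr K₀).natAbs) χ *
              changeLevel (dvd_mul_left (NumberField.discr K₀).natAbs m) ε₀).conductor ⟨conductor_ne_zero _⟩ k
            (changeLevel (dvd_mul_right m (NumberField.discr K₀).natAbs) χ *
              changeLevel (dvd_mul_left (NumberField.discr K₀).natAbs m) ε₀).primitiveCharacter‖ ≤ (p : ℝ)⁻¹) →
      ∀ (K₀ : Type) [Field K₀] [NumberField K₀] (ε₀ : DirichletCharacter ℚ_[p] (NumberField.discr K₀).natAbs),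
        IsImaginaryQuadratic K₀ → Odd (NumberField.discr K₀) → NumberField.discr K₀ < -4 →
        ¬ ((3 : ℤ) ∣ NumberField.discr K₀) →
        (∀ q' : ℕ, q'.Prime → q' ∣ m → q' ≠ 2 → jacobiSym (NumberField.discr K₀) q' = τ q') →
        NumberField.discr K₀ % 8 = 5 → IsKroneckerCharacterOf K₀ ε₀ →
        ‖(k : ℚ_[p])⁻¹ * @generalizedBernoulli ℚ_[p] _ _
            (changeLevel (dvd_mul_right m (NumberField.discr K₀).natAbs) χ *
              changeLevel (dvd_mul_left (NumberField.discr K₀).natAbs m) ε₀).conductor ⟨conductor_ne_zero _⟩ k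
            (changeLevel (dvd_mul_right m (NumberField.discr K₀).natAbs) χ *
              changeLevel (dvd_mul_left (NumberField.discr K₀).natAbs m) ε₀).primitiveCharacter‖ ≤ (p : ℝ)⁻¹)
    (hBadOddQ : ∀ (p : ℕ) [Fact p.Prime] (m : ℕ) [NeZero m] (χ : DirichletCharacter ℚ_[p] m) (k : ℕ),
      (p = 7 ∨ p = 11 ∨ p = 19 ∨ p = 43 ∨ p = 67 ∨ p = 163) →
      m.Coprime p → χ.IsPrimitive → χ.IsQuadratic → (k = (p + 1) / 4 ∨ k = (3 * p - 1) / 4) →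
      2 ≤ k → k ≤ p - 2 → χ (-1) * (-1) ^ k = -1 →
      ¬ ((∀ q : ℕ, q.Prime → q ∣ m → q ≠ 2 → jacobiSym (-(p : ℤ)) q = 1) ∧ (2 ∣ m → p % 8 = 7)) →
      (∃ ℓ : ℕ, ℓ.Prime ∧ ℓ ∣ m ∧ (ℓ % p = 1 ∨ ℓ % p = p - 1)) →
      Q p m χ k →
      (∃ q : ℕ, q.Prime ∧ q ∣ m ∧ q % (4 * p) = 4 * p - 1) →
      ¬ ‖((p - k : ℕ) : ℚ_[p])⁻¹ * generalizedBernoulli (p - k) χ‖ ≤ (p : ℝ)⁻¹ →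
      ∃ (K₀ : Type) (_ : Field K₀) (_ : NumberField K₀) (ε₀ : DirichletCharacter ℚ_[p] (NumberField.discr K₀).natAbs),
        IsImaginaryQuadratic K₀ ∧
        (∀ q : ℕ, q.Prime → q ∣ m → ((Ideal.span {(q : ℤ)}).primesOver (𝓞 K₀)).ncard = 2) ∧
        Odd (NumberField.discr K₀) ∧ NumberField.discr K₀ < -4 ∧ IsKroneckerCharacterOf K₀ ε₀ ∧
        ¬ ‖(k : ℚ_[p])⁻¹ * @generalizedBernoulli ℚ_[p] _ _
            (changeLevel (dvd_mul_right m (NumberField.discr K₀).natAbs) χ *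
              changeLevel (dvd_mul_left (NumberField.discr K₀).natAbs m) ε₀).conductor ⟨conductor_ne_zero _⟩ k
            (changeLevel (dvd_mul_right m (NumberField.discr K₀).natAbs) χ *
              changeLevel (dvd_mul_left (NumberField.discr K₀).natAbs m) ε₀).primitiveCharacter‖ ≤ (p : ℝ)⁻¹) :
    ∀ (p : ℕ) [Fact p.Prime] (m : ℕ) [NeZero m] (χ : DirichletCharacter ℚ_[p] m) (k : ℕ),
      (p = 7 ∨ p = 11 ∨ p = 19 ∨ p = 43 ∨ p = 67 ∨ p = 163) →
      m.Coprime p → χ.IsPrimitive → χ.IsQuadratic → (k = (p + 1) / 4 ∨ k = (3 * p - 1) / 4) →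
      2 ≤ k → k ≤ p - 2 → χ (-1) * (-1) ^ k = -1 →
      ¬ ((∀ q : ℕ, q.Prime → q ∣ m → q ≠ 2 → jacobiSym (-(p : ℤ)) q = 1) ∧ (2 ∣ m → p % 8 = 7)) →
      (∃ ℓ : ℕ, ℓ.Prime ∧ ℓ ∣ m ∧ (ℓ % p = 1 ∨ ℓ % p = p - 1)) →
      Q p m χ k →
      ¬ ‖((p - k : ℕ) : ℚ_[p])⁻¹ * generalizedBernoulli (p - k) χ‖ ≤ (p : ℝ)⁻¹ →
      ∃ (K₀ : Type) (_ : Field K₀) (_ : NumberField K₀) (ε₀ : DirichletCharacter ℚ_[p] (NumberField.discr K₀).natAbs),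
        IsImaginaryQuadratic K₀ ∧
        (∀ q : ℕ, q.Prime → q ∣ m → ((Ideal.span {(q : ℤ)}).primesOver (𝓞 K₀)).ncard = 2) ∧
        Odd (NumberField.discr K₀) ∧ NumberField.discr K₀ < -4 ∧ IsKroneckerCharacterOf K₀ ε₀ ∧
        ¬ ‖(k : ℚ_[p])⁻¹ * @generalizedBernoulli ℚ_[p] _ _
            (changeLevel (dvd_mul_right m (NumberField.discr K₀).natAbs) χ *
              changeLevel (dvd_mul_left (NumberField.discr K₀).natAbs m) ε₀).conductor ⟨conductor_ne_zero _⟩ k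
            (changeLevel (dvd_mul_right m (NumberField.discr K₀).natAbs) χ *
              changeLevel (dvd_mul_left (NumberField.discr K₀).natAbs m) ε₀).primitiveCharacter‖ ≤ (p : ℝ)⁻¹ := by
  intro p _ m _ χ k hp6 hmp hχ hχq hk hk2 hkp hpar hoff hexc hQ hreg
  by_cases hb : ∃ q : ℕ, q.Prime ∧ q ∣ m ∧ q % (4 * p) = 4 * p - 1
  · exact hBadOddQ p m χ k hp6 hmp hχ hχq hk hk2 hkp hpar hoff hexc hQ hb hreg
  have hnb : ∀ q : ℕ, ¬ (q.Prime ∧ q ∣ m ∧ q % (4 * p) = 4 * p - 1) := fun q h => hb ⟨q, h⟩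
  have hpp : p.Prime := Fact.out
  have hp3 : p % 4 = 3 := by rcases hp6 with h | h | h | h | h | h <;> subst h <;> norm_num
  have h7 : 7 ≤ p := by rcases hp6 with h | h | h | h | h | h <;> omega
  have hp2 : p ≠ 2 := by omega
  have hm0 : m ≠ 0 := NeZero.ne m
  by_contra H
  -- Step 1: the all-split pattern carries no unit (restricted to `3 ∤ d`)
  have hV1 : ∀ (K₀ : Type) [Field K₀] [NumberField K₀] (ε₀ : DirichletCharacter ℚ_[p] (NumberField.discr K₀).natAbs),
      IsImaginaryQuadratic K₀ → Odd (NumberField.discr K₀) → NumberField.discr K₀ < -4 →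
      ¬ ((3 : ℤ) ∣ NumberField.discr K₀) →
      (∀ q' : ℕ, q'.Prime → q' ∣ m → q' ≠ 2 → jacobiSym (NumberField.discr K₀) q' = (fun _ : ℕ => (1 : ℤ)) q') →
      (2 ∣ m → NumberField.discr K₀ % 8 = 1) → IsKroneckerCharacterOf K₀ ε₀ →
      ‖(k : ℚ_[p])⁻¹ * @generalizedBernoulli ℚ_[p] _ _
            (changeLevel (dvd_mul_right m (NumberField.discr K₀).natAbs) χ *
              changeLevel (dvd_mul_left (NumberField.discr K₀).natAbs m) ε₀).conductor ⟨conductor_ne_zero _⟩ k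
            (changeLevel (dvd_mul_right m (NumberField.discr K₀).natAbs) χ *
              changeLevel (dvd_mul_left (NumberField.discr K₀).natAbs m) ε₀).primitiveCharacter‖ ≤ (p : ℝ)⁻¹ := by
    intro K₀ _ _ ε₀ hK hodd hlt _h3 hpat h8 hε
    by_contra hunit
    apply H
    refine ⟨K₀, inferInstance, inferInstance, ε₀, hK, ?_, hodd, hlt, hε, hunit⟩
    intro q hq hqm
    by_cases hq2 : q = 2
    · subst hq2
      have h := (Quadratic.ncard_primesOver_two_eq_two_iff hK.1).mpr (h8 hqm)
      simpa using h
    · rw [Quadratic.ncard_primesOver_eq_two_iff_jacobiSym hK.1 hq hq2]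
      exact hpat q hq hqm hq2
  -- Step 2: flip, one prime at a time, every odd `q ∣ m` inert in `ℚ(√−p)`
  set Qoff : Finset ℕ := m.primeFactors.filter (fun q => q ≠ 2 ∧ jacobiSym (-(p : ℤ)) q = -1) with hQoff
  have hstep : ∀ S : Finset ℕ, S ⊆ Qoff →
      ∀ (K₀ : Type) [Field K₀] [NumberField K₀] (ε₀ : DirichletCharacter ℚ_[p] (NumberField.discr K₀).natAbs),
      IsImaginaryQuadratic K₀ → Odd (NumberField.discr K₀) → NumberField.discr K₀ < -4 →
      ¬ ((3 : ℤ) ∣ NumberField.discr K₀) →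
      (∀ q' : ℕ, q'.Prime → q' ∣ m → q' ≠ 2 →
        jacobiSym (NumberField.discr K₀) q' = (fun x : ℕ => if x ∈ S then (-1 : ℤ) else 1) q') →
      (2 ∣ m → NumberField.discr K₀ % 8 = 1) → IsKroneckerCharacterOf K₀ ε₀ →
      ‖(k : ℚ_[p])⁻¹ * @generalizedBernoulli ℚ_[p] _ _
            (changeLevel (dvd_mul_right m (NumberField.discr K₀).natAbs) χ *
              changeLevel (dvd_mul_left (NumberField.discr K₀).natAbs m) ε₀).conductor ⟨conductor_ne_zero _⟩ k
            (changeLevel (dvd_mul_right m (NumberField.discr K₀).natAbs) χ *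
              changeLevel (dvd_mul_left (NumberField.discr K₀).natAbs m) ε₀).primitiveCharacter‖ ≤ (p : ℝ)⁻¹ := by
    intro S
    induction S using Finset.induction_on with
    | empty =>
      intro _ K₀ _ _ ε₀ hK hodd hlt h3 hpat h8 hε
      exact hV1 K₀ ε₀ hK hodd hlt h3 (fun q' hq' hq'm hq'2 => by simpa using hpat q' hq' hq'm hq'2) h8 hε
    | @insert q S hqS ih =>
      intro hsub
      have hqQ : q ∈ Qoff := hsub (Finset.mem_insert_self q S)
      have hS : S ⊆ Qoff := fun x hx => hsub (Finset.mem_insert_of_mem hx)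
      have hqQ' : q ∈ m.primeFactors ∧ q ≠ 2 ∧ jacobiSym (-(p : ℤ)) q = -1 := by
        simpa [hQoff, Finset.mem_filter] using hqQ
      obtain ⟨hqpf, hq2, hJq⟩ := hqQ'
      have hq : q.Prime := Nat.prime_of_mem_primeFactors hqpf
      have hqm : q ∣ m := Nat.dvd_of_mem_primeFactors hqpf
      have hstar : ¬ ((p : ℤ) ∣ (q : ℤ) * jacobiSym (-1) q - 1) := fun h =>
        hnb q ⟨hq, hqm, mod_four_mul_eq_of_jacobiSym_neg_eq_neg_one_of_dvd hpp hp2 hq hq2 hJq h⟩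
      have hτ : ∀ q' : ℕ, q'.Prime → q' ∣ m → q' ≠ 2 →
          ((fun x : ℕ => if x ∈ S then (-1 : ℤ) else 1) q' = 1 ∨ (fun x : ℕ => if x ∈ S then (-1 : ℤ) else 1) q' = -1) := by
        intro q' _ _ _
        by_cases h : q' ∈ S <;> simp [h]
      have hflip := hFlip p m χ k hp6 hmp hχ hχq hk hk2 hkp hpar (fun x : ℕ => if x ∈ S then (-1 : ℤ) else 1) q hq hqm hq2
        hτ hstar (ih hS)
      intro K₀ _ _ ε₀ hK hodd hlt h3 hpat h8 hε
      refine hflip K₀ ε₀ hK hodd hlt h3 ?_ h8 hε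
      intro q' hq' hq'm hq'2
      rw [hpat q' hq' hq'm hq'2]
      by_cases hqq : q' = q
      · subst hqq
        simp [hqS]
      · simp [Finset.mem_insert, hqq]
  have hVQ := hstep Qoff subset_rfl
  -- Step 3: read at `K₀ = ℚ(√−p)`, whose pattern is `q ↦ J(−p | q)` and whose field factor is the reflected class factor;
  -- when `2 ∣ m` and `p ≢ 7 (mod 8)` the 2-adic datum `d % 8 = 1` is first FLIPPED to `d % 8 = 5` by `hFlipTwo`.
  obtain ⟨K₀, iF, iN, ε₀, hK, hd, hε, himp⟩ := exists_cmField_fieldFactor_le_imp hp6 m χ k hmp hχ hk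
  have hoddK : Odd (NumberField.discr K₀) := by
    rw [hd]
    exact (Int.odd_coe_nat p |>.mpr (hpp.eq_two_or_odd'.resolve_left hp2)).neg
  have hltK : NumberField.discr K₀ < -4 := by rw [hd]; omega
  have h3K : ¬ ((3 : ℤ) ∣ NumberField.discr K₀) := by
    rw [hd, Int.dvd_neg]
    intro h3
    have h3' : 3 ∣ p := by exact_mod_cast h3
    have := (Nat.prime_dvd_prime_iff_eq Nat.prime_three hpp).mp h3'
    omega
  have hpatK : ∀ q' : ℕ, q'.Prime → q' ∣ m → q' ≠ 2 →
      jacobiSym (NumberField.discr K₀) q' = (fun x : ℕ => if x ∈ Qoff then (-1 : ℤ) else 1) q' := by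
    intro q' hq' hq'm hq'2
    rw [hd]
    have hq'p : q' ≠ p := by
      rintro rfl
      have : Nat.Coprime q' q' := Nat.Coprime.coprime_dvd_left hq'm hmp
      rw [Nat.coprime_self] at this
      exact hq'.ne_one this
    by_cases hmem : q' ∈ Qoff
    · have hmem' : q' ∈ m.primeFactors ∧ q' ≠ 2 ∧ jacobiSym (-(p : ℤ)) q' = -1 := by
        simpa [hQoff, Finset.mem_filter] using hmem
      simp only [hmem, if_true]
      exact hmem'.2.2
    · simp only [hmem, if_false]
      have hgcd : Int.gcd (-(p : ℤ)) q' = 1 := by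
        rw [Int.neg_gcd, Int.gcd_natCast_natCast]
        exact (Nat.coprime_primes hpp hq').mpr (Ne.symm hq'p)
      rcases jacobiSym.eq_one_or_neg_one hgcd with h1 | h1
      · exact h1
      · exfalso
        apply hmem
        simp only [hQoff, Finset.mem_filter, Nat.mem_primeFactors]
        exact ⟨⟨hq', hq'm, hm0⟩, hq'2, h1⟩
  apply hreg
  apply himp
  by_cases h8 : 2 ∣ m → p % 8 = 7
  · -- `2 ∤ m`, or `p ≡ 7 (mod 8)` (then `d = −p ≡ 1 (mod 8)`): read directly
    refine hVQ K₀ ε₀ hK hoddK hltK h3K hpatK ?_ hε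
    intro h2m
    rw [hd]
    have := h8 h2m
    omega
  · -- `2 ∣ m` and `p ≢ 7 (mod 8)`: `p ≡ 3 (mod 8)`, `d = −p ≡ 5 (mod 8)`; flip the 2-adic datum first
    have h2m : 2 ∣ m := by
      by_contra h
      exact h8 (fun h2 => absurd h2 h)
    have hp8 : p % 8 ≠ 7 := fun h' => h8 (fun _ => h')
    have hτ : ∀ q' : ℕ, q'.Prime → q' ∣ m → q' ≠ 2 →
        ((fun x : ℕ => if x ∈ Qoff then (-1 : ℤ) else 1) q' = 1 ∨ (fun x : ℕ => if x ∈ Qoff then (-1 : ℤ) else 1) q' = -1) := by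
      intro q' _ _ _
      by_cases h : q' ∈ Qoff <;> simp [h]
    have hV5 := hFlipTwo p m χ k hp6 hmp hχ hχq hk hk2 hkp hpar h2m (fun x : ℕ => if x ∈ Qoff then (-1 : ℤ) else 1) hτ
      (fun K₁ _ _ ε₁ hK₁ hodd₁ hlt₁ h3₁ hpat₁ h8₁ hε₁ => hVQ K₁ ε₁ hK₁ hodd₁ hlt₁ h3₁ hpat₁ (fun _ => h8₁) hε₁)
    refine hV5 K₀ ε₀ hK hoddK hltK h3K hpatK ?_ hε
    rw [hd]
    omega

/-- **Registry v26's `stub_seedOffExc` (VERBATIM) ⟸ (FlipRung⁶) ∧ (FlipRungTwo⁶) ∧ (SeedOffExcBadOdd⁶)** — the side condition of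
`seedOffExc_of_flipRung_of_flipRungTwo_of_badOdd_cut` set to `True`: the research residue of the analytic stub is «∃ prime `q ∣ m`,
`q ≡ −1 (mod 4p)`» ALONE (the 2-adic clause of LEAD's (SeedOffExcBad⁶) is discharged by the 2-adic rung). Nothing about BSD.
[cite: Cohen1975, Thm. 3.1] [cite: Katz1973, Cor. 1.6.2] [cite: Washington1997, Thm. 5.11] [cite: KrizLi2019, §8 (pp. 49–52)] -/
theorem seedOffExc_of_flipRung_of_flipRungTwo_of_badOdd
    (hFlip : ∀ (p : ℕ) [Fact p.Prime] (m : ℕ) [NeZero m] (χ : DirichletCharacter ℚ_[p] m) (k : ℕ),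
      (p = 7 ∨ p = 11 ∨ p = 19 ∨ p = 43 ∨ p = 67 ∨ p = 163) →
      m.Coprime p → χ.IsPrimitive → χ.IsQuadratic → (k = (p + 1) / 4 ∨ k = (3 * p - 1) / 4) →
      2 ≤ k → k ≤ p - 2 → χ (-1) * (-1) ^ k = -1 →
      ∀ (τ : ℕ → ℤ) (q : ℕ), q.Prime → q ∣ m → q ≠ 2 →
      (∀ q' : ℕ, q'.Prime → q' ∣ m → q' ≠ 2 → (τ q' = 1 ∨ τ q' = -1)) →
      ¬ ((p : ℤ) ∣ (q : ℤ) * jacobiSym (-1) q - 1) →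
      (∀ (K₀ : Type) [Field K₀] [NumberField K₀] (ε₀ : DirichletCharacter ℚ_[p] (NumberField.discr K₀).natAbs),
        IsImaginaryQuadratic K₀ → Odd (NumberField.discr K₀) → NumberField.discr K₀ < -4 →
        ¬ ((3 : ℤ) ∣ NumberField.discr K₀) →
        (∀ q' : ℕ, q'.Prime → q' ∣ m → q' ≠ 2 → jacobiSym (NumberField.discr K₀) q' = τ q') →
        (2 ∣ m → NumberField.discr K₀ % 8 = 1) → IsKroneckerCharacterOf K₀ ε₀ →
        ‖(k : ℚ_[p])⁻¹ * @generalizedBernoulli ℚ_[p] _ _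
            (changeLevel (dvd_mul_right m (NumberField.discr K₀).natAbs) χ *
              changeLevel (dvd_mul_left (NumberField.discr K₀).natAbs m) ε₀).conductor ⟨conductor_ne_zero _⟩ k
            (changeLevel (dvd_mul_right m (NumberField.discr K₀).natAbs) χ *
              changeLevel (dvd_mul_left (NumberField.discr K₀).natAbs m) ε₀).primitiveCharacter‖ ≤ (p : ℝ)⁻¹) →
      ∀ (K₀ : Type) [Field K₀] [NumberField K₀] (ε₀ : DirichletCharacter ℚ_[p] (NumberField.discr K₀).natAbs),
        IsImaginaryQuadratic K₀ → Odd (NumberField.discr K₀) → NumberField.discr K₀ < -4 →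
        ¬ ((3 : ℤ) ∣ NumberField.discr K₀) →
        (∀ q' : ℕ, q'.Prime → q' ∣ m → q' ≠ 2 → jacobiSym (NumberField.discr K₀) q' = (if q' = q then -τ q' else τ q')) →
        (2 ∣ m → NumberField.discr K₀ % 8 = 1) → IsKroneckerCharacterOf K₀ ε₀ →
        ‖(k : ℚ_[p])⁻¹ * @generalizedBernoulli ℚ_[p] _ _
            (changeLevel (dvd_mul_right m (NumberField.discr K₀).natAbs) χ *
              changeLevel (dvd_mul_left (NumberField.discr K₀).natAbs m) ε₀).conductor ⟨conductor_ne_zero _⟩ k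
            (changeLevel (dvd_mul_right m (NumberField.discr K₀).natAbs) χ *
              changeLevel (dvd_mul_left (NumberField.discr K₀).natAbs m) ε₀).primitiveCharacter‖ ≤ (p : ℝ)⁻¹)
    (hFlipTwo : ∀ (p : ℕ) [Fact p.Prime] (m : ℕ) [NeZero m] (χ : DirichletCharacter ℚ_[p] m) (k : ℕ),
      (p = 7 ∨ p = 11 ∨ p = 19 ∨ p = 43 ∨ p = 67 ∨ p = 163) →
      m.Coprime p → χ.IsPrimitive → χ.IsQuadratic → (k = (p + 1) / 4 ∨ k = (3 * p - 1) / 4) →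
      2 ≤ k → k ≤ p - 2 → χ (-1) * (-1) ^ k = -1 → 2 ∣ m →
      ∀ (τ : ℕ → ℤ), (∀ q' : ℕ, q'.Prime → q' ∣ m → q' ≠ 2 → (τ q' = 1 ∨ τ q' = -1)) →
      (∀ (K₀ : Type) [Field K₀] [NumberField K₀] (ε₀ : DirichletCharacter ℚ_[p] (NumberField.discr K₀).natAbs),
        IsImaginaryQuadratic K₀ → Odd (NumberField.discr K₀) → NumberField.discr K₀ < -4 →
        ¬ ((3 : ℤ) ∣ NumberField.discr K₀) →
        (∀ q' : ℕ, q'.Prime → q' ∣ m → q' ≠ 2 → jacobiSym (NumberField.discr K₀) q' = τ q') →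
        NumberField.discr K₀ % 8 = 1 → IsKroneckerCharacterOf K₀ ε₀ →
        ‖(k : ℚ_[p])⁻¹ * @generalizedBernoulli ℚ_[p] _ _
            (changeLevel (dvd_mul_right m (NumberField.discr K₀).natAbs) χ *
              changeLevel (dvd_mul_left (NumberField.discr K₀).natAbs m) ε₀).conductor ⟨conductor_ne_zero _⟩ k
            (changeLevel (dvd_mul_right m (NumberField.discr K₀).natAbs) χ *
              changeLevel (dvd_mul_left (NumberField.discr K₀).natAbs m) ε₀).primitiveCharacter‖ ≤ (p : ℝ)⁻¹) →
      ∀ (K₀ : Type) [Field K₀] [NumberField K₀] (ε₀ : DirichletCharacter ℚ_[p] (NumberField.discr K₀).natAbs),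
        IsImaginaryQuadratic K₀ → Odd (NumberField.discr K₀) → NumberField.discr K₀ < -4 →
        ¬ ((3 : ℤ) ∣ NumberField.discr K₀) →
        (∀ q' : ℕ, q'.Prime → q' ∣ m → q' ≠ 2 → jacobiSym (NumberField.discr K₀) q' = τ q') →
        NumberField.discr K₀ % 8 = 5 → IsKroneckerCharacterOf K₀ ε₀ →
        ‖(k : ℚ_[p])⁻¹ * @generalizedBernoulli ℚ_[p] _ _
            (changeLevel (dvd_mul_right m (NumberField.discr K₀).natAbs) χ *
              changeLevel (dvd_mul_left (NumberField.discr K₀).natAbs m) ε₀).conductor ⟨conductor_ne_zero _⟩ k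
            (changeLevel (dvd_mul_right m (NumberField.discr K₀).natAbs) χ *
              changeLevel (dvd_mul_left (NumberField.discr K₀).natAbs m) ε₀).primitiveCharacter‖ ≤ (p : ℝ)⁻¹)
    (hBadOdd : ∀ (p : ℕ) [Fact p.Prime] (m : ℕ) [NeZero m] (χ : DirichletCharacter ℚ_[p] m) (k : ℕ),
      (p = 7 ∨ p = 11 ∨ p = 19 ∨ p = 43 ∨ p = 67 ∨ p = 163) →
      m.Coprime p → χ.IsPrimitive → χ.IsQuadratic → (k = (p + 1) / 4 ∨ k = (3 * p - 1) / 4) →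
      2 ≤ k → k ≤ p - 2 → χ (-1) * (-1) ^ k = -1 →
      ¬ ((∀ q : ℕ, q.Prime → q ∣ m → q ≠ 2 → jacobiSym (-(p : ℤ)) q = 1) ∧ (2 ∣ m → p % 8 = 7)) →
      (∃ ℓ : ℕ, ℓ.Prime ∧ ℓ ∣ m ∧ (ℓ % p = 1 ∨ ℓ % p = p - 1)) →
      (∃ q : ℕ, q.Prime ∧ q ∣ m ∧ q % (4 * p) = 4 * p - 1) →
      ¬ ‖((p - k : ℕ) : ℚ_[p])⁻¹ * generalizedBernoulli (p - k) χ‖ ≤ (p : ℝ)⁻¹ →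
      ∃ (K₀ : Type) (_ : Field K₀) (_ : NumberField K₀) (ε₀ : DirichletCharacter ℚ_[p] (NumberField.discr K₀).natAbs),
        IsImaginaryQuadratic K₀ ∧
        (∀ q : ℕ, q.Prime → q ∣ m → ((Ideal.span {(q : ℤ)}).primesOver (𝓞 K₀)).ncard = 2) ∧
        Odd (NumberField.discr K₀) ∧ NumberField.discr K₀ < -4 ∧ IsKroneckerCharacterOf K₀ ε₀ ∧
        ¬ ‖(k : ℚ_[p])⁻¹ * @generalizedBernoulli ℚ_[p] _ _
            (changeLevel (dvd_mul_right m (NumberField.discr K₀).natAbs) χ *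
              changeLevel (dvd_mul_left (NumberField.discr K₀).natAbs m) ε₀).conductor ⟨conductor_ne_zero _⟩ k
            (changeLevel (dvd_mul_right m (NumberField.discr K₀).natAbs) χ *
              changeLevel (dvd_mul_left (NumberField.discr K₀).natAbs m) ε₀).primitiveCharacter‖ ≤ (p : ℝ)⁻¹) :
    ∀ (p : ℕ) [Fact p.Prime] (m : ℕ) [NeZero m] (χ : DirichletCharacter ℚ_[p] m) (k : ℕ),
      (p = 7 ∨ p = 11 ∨ p = 19 ∨ p = 43 ∨ p = 67 ∨ p = 163) →
      m.Coprime p → χ.IsPrimitive → χ.IsQuadratic → (k = (p + 1) / 4 ∨ k = (3 * p - 1) / 4) →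
      2 ≤ k → k ≤ p - 2 → χ (-1) * (-1) ^ k = -1 →
      ¬ ((∀ q : ℕ, q.Prime → q ∣ m → q ≠ 2 → jacobiSym (-(p : ℤ)) q = 1) ∧ (2 ∣ m → p % 8 = 7)) →
      (∃ ℓ : ℕ, ℓ.Prime ∧ ℓ ∣ m ∧ (ℓ % p = 1 ∨ ℓ % p = p - 1)) →
      ¬ ‖((p - k : ℕ) : ℚ_[p])⁻¹ * generalizedBernoulli (p - k) χ‖ ≤ (p : ℝ)⁻¹ →
      ∃ (K₀ : Type) (_ : Field K₀) (_ : NumberField K₀) (ε₀ : DirichletCharacter ℚ_[p] (NumberField.discr K₀).natAbs),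
        IsImaginaryQuadratic K₀ ∧
        (∀ q : ℕ, q.Prime → q ∣ m → ((Ideal.span {(q : ℤ)}).primesOver (𝓞 K₀)).ncard = 2) ∧
        Odd (NumberField.discr K₀) ∧ NumberField.discr K₀ < -4 ∧ IsKroneckerCharacterOf K₀ ε₀ ∧
        ¬ ‖(k : ℚ_[p])⁻¹ * @generalizedBernoulli ℚ_[p] _ _
            (changeLevel (dvd_mul_right m (NumberField.discr K₀).natAbs) χ *
              changeLevel (dvd_mul_left (NumberField.discr K₀).natAbs m) ε₀).conductor ⟨conductor_ne_zero _⟩ k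
            (changeLevel (dvd_mul_right m (NumberField.discr K₀).natAbs) χ *
              changeLevel (dvd_mul_left (NumberField.discr K₀).natAbs m) ε₀).primitiveCharacter‖ ≤ (p : ℝ)⁻¹ :=
  fun p _ m _ χ k hp6 hmp hχ hχq hk hk2 hkp hpar hoff hexc hreg =>
    seedOffExc_of_flipRung_of_flipRungTwo_of_badOdd_cut (fun _ _ _ _ _ => True) hFlip hFlipTwo
      (fun p _ m _ χ k hp6 hmp hχ hχq hk hk2 hkp hpar hoff hexc _ hb hreg =>
        hBadOdd p m χ k hp6 hmp hχ hχq hk hk2 hkp hpar hoff hexc hb hreg)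
      p m χ k hp6 hmp hχ hχq hk hk2 hkp hpar hoff hexc trivial hreg

end Summit.BirchSwinnertonDyer.BirchSwinnertonDyer.Theorems.PrintCFram.FlipRung

end
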